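import Mathlib
import Summits.ValiantsHypothesis.ValiantsHypothesis.Theorems.GrenetZeonPolySizeQPAlgebraSymmetrisedFormOneTwoOneOne
import HarnessLib

/-!
# Crux `GrenetZeon.PolySizeQPAlgebra` (stmt-ValiantsHypothesis-8064), line `vbp-slice-dealg` —
# the top of the window (`q = 4 = ν`) for the deep dimension-five type `(1,2,1,1)`

Companion of `…SymmetrisedFormOneTwoOneOne` (`q = 3`).  Over the presented ring `R = ℂ[x,y]/(xy, y² - x³)`
(`xy = 0`, `y² = x³`, `x⁴ = 0`, `R = ℂ + Rx + Ry`) a residual block `S ∈ Mat₄(𝔪)` has `adj S ∈ Mat₄(𝔪³)`,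
`𝔪³ = x³R = ℂx³`, so `dim Col(adj S), dim Row(adj S) ≤ 4` (`AL(4)` with room), and every coordinate of the
representing vectors `Ψ_s` of the symmetrised form lies in `𝔪² = x²R = ℂx² + ℂx³` (each `4 × 4`
determinant keeps two rows of `S`), so `rank G ≤ 2 + 2·16 = 34 < 40`.  Hence

* `finrank_range_adjugate_mulVecLin_le_four_of_oneTwoOneOne`, `rank_symmetrised_fin_four_form_le_of_oneTwoOneOne`,
* `rank_hess0_transl_le_blockNormalForm_four_of_oneTwoOneOne[']` — at `A(p) = diag(1_κ, S)`,
  `S ∈ Mat₄(𝔪)` (no condition on `det S`): `rank Hess λ(det A)(p) ≤ 34 + 8|κ| ≤ 2·dim R·(|κ| + 4)`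
  when `dim R ≥ 5`.

With the `q = 3` file this closes the window `3 ≤ q ≤ ν = 4` of input (B) for the type `(1,2,1,1)` in
block normal form; the transport to the socket of `not_hasAlgDetRepr_perPoly_self_of_deepBound`, the
classification "deep of dimension 5 ⟹ this presentation" and (A₆) remain.  HONEST FRAMING: a length
count; no stub of the line is closed; VP ≠ VNP is not moved.

References: T. Mignon, N. Ressayre, IMRN 2004:79, §2 [MignonRessayre2004].
-/

noncomputable section

open Matrix MvPolynomial
open Literature.Computability.AlgebraicComplexity

-- single-conjunct layout `Summits/ValiantsHypothesis/ValiantsHypothesis`: duplicated namespace by design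
set_option linter.dupNamespace false

namespace Summit.ValiantsHypothesis.ValiantsHypothesis.Theorems.GrenetZeonPolySizeQPAlgebra

section GFour

variable {R : Type*} [CommRing R]

/-- For `r r' : Fin 4` there are two further distinct indices. [folklore] -/
theorem exists_fin_four_ne_ne (r r' : Fin 4) :
    ∃ m m' : Fin 4, m ≠ m' ∧ m ≠ r ∧ m ≠ r' ∧ m' ≠ r ∧ m' ≠ r' := by
  revert r r'; decide

/-- A `4 × 4` determinant of `S ∈ Mat₄(I)` with two rows replaced keeps two rows in `I`, so lies in `I²`.
[folklore] -/
theorem det_updateRow_updateRow_mem_sq_four (I : Ideal R) (S : Matrix (Fin 4) (Fin 4) R)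
    (hS : ∀ i j, S i j ∈ I) (r r' : Fin 4) (v w : Fin 4 → R) :
    ((S.updateRow r v).updateRow r' w).det ∈ I ^ 2 := by
  classical
  obtain ⟨m, m', hmm', hmr, hmr', hm'r, hm'r'⟩ := exists_fin_four_ne_ne r r'
  have hcard : ({m, m'} : Finset (Fin 4)).card = 2 := Finset.card_pair hmm'
  have h := det_mem_pow_of_rows_mem I ((S.updateRow r v).updateRow r' w) {m, m'} fun i hi j => by
    rcases Finset.mem_insert.1 hi with rfl | hi
    · rw [Matrix.updateRow_ne hmr', Matrix.updateRow_ne hmr]; exact hS i j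
    · rw [Finset.mem_singleton] at hi
      subst hi
      rw [Matrix.updateRow_ne hm'r', Matrix.updateRow_ne hm'r]
      exact hS i j
  rwa [hcard] at h

/-- In the presented ring: `(x, y)³ ⊆ x³R`. [folklore] -/
theorem cube_span_pair_le_span_cube {x y : R} (hxy : x * y = 0) (hyy : y * y = x ^ 3) :
    (Ideal.span {x, y} : Ideal R) ^ 3 ≤ Ideal.span {x ^ 3} := by
  rw [pow_succ, Ideal.mul_le]
  intro u hu v hv
  obtain ⟨t, rfl⟩ := Ideal.mem_span_singleton'.1 (sq_span_pair_le_span_sq hxy hyy hu)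
  obtain ⟨a, b, rfl⟩ := Ideal.mem_span_pair.1 hv
  exact Ideal.mem_span_singleton'.2 ⟨t * a, by linear_combination (-(t * b * x)) * hxy⟩

variable [Algebra ℂ R]

/-- In the presented ring: `x³R = ℂx³`. [folklore] -/
theorem mul_cube_eq_smul {x y : R} (hxy : x * y = 0) (hx4 : x ^ 4 = 0)
    (hloc : ∀ r : R, ∃ (c : ℂ) (a b : R), r = algebraMap ℂ R c + a * x + b * y) (t : R) :
    ∃ c : ℂ, t * x ^ 3 = c • x ^ 3 := by
  obtain ⟨c, a, b, rfl⟩ := hloc t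
  refine ⟨c, ?_⟩
  rw [Algebra.smul_def]
  linear_combination b * x ^ 2 * hxy + a * hx4

variable [Module.Finite ℂ R]

omit [Module.Finite ℂ R] in
/-- **`dim_ℂ Col(adj S) ≤ 4` for `S ∈ Mat₄(𝔪)` over the type `(1,2,1,1)`** (`adj S ∈ Mat₄(𝔪³)`,
`𝔪³ = ℂx³`). [folklore] -/
theorem finrank_range_adjugate_mulVecLin_le_four_of_oneTwoOneOne {x y : R} (hxy : x * y = 0)
    (hyy : y * y = x ^ 3) (hx4 : x ^ 4 = 0)
    (hloc : ∀ r : R, ∃ (c : ℂ) (a b : R), r = algebraMap ℂ R c + a * x + b * y)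
    (S : Matrix (Fin 4) (Fin 4) R) (hS : ∀ i j, ∃ a b, S i j = a * x + b * y) :
    Module.finrank ℂ (LinearMap.range (S.adjugate.mulVecLin.restrictScalars ℂ)) ≤ 4 := by
  classical
  set I : Ideal R := Ideal.span {x, y} with hI
  have hSI : ∀ i j, S i j ∈ I := fun i j => by
    obtain ⟨a, b, h⟩ := hS i j
    exact Ideal.mem_span_pair.2 ⟨a, b, h.symm⟩
  have hadj : ∀ i j, S.adjugate i j ∈ Ideal.span {x ^ 3} := by
    intro i j
    have h := adjugate_apply_mem_pow I S hSI i j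
    simp only [Fintype.card_fin] at h
    exact cube_span_pair_le_span_cube hxy hyy h
  let T : (Fin 4 → ℂ) →ₗ[ℂ] (Fin 4 → R) :=
    { toFun := fun c => fun i => c i • x ^ 3
      map_add' := fun u v => by ext i; simp only [Pi.add_apply, add_smul]
      map_smul' := fun k u => by
        ext i; simp only [Pi.smul_apply, smul_eq_mul, RingHom.id_apply, mul_smul] }
  have hT : Module.finrank ℂ (LinearMap.range T) ≤ 4 := by
    refine (LinearMap.finrank_range_le T).trans ?_
    rw [Module.finrank_fin_fun]
  refine le_trans (Submodule.finrank_mono ?_) hT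
  rintro v ⟨w, rfl⟩
  have hentry : ∀ i, (S.adjugate *ᵥ w) i ∈ Ideal.span {x ^ 3} := by
    intro i
    rw [Matrix.mulVec, dotProduct]
    exact Ideal.sum_mem _ fun j _ => Ideal.mul_mem_right _ _ (hadj i j)
  choose c hc using fun i =>
    mul_cube_eq_smul hxy hx4 hloc (Classical.choose (Ideal.mem_span_singleton'.1 (hentry i)))
  refine ⟨c, ?_⟩
  ext i
  have hi := Classical.choose_spec (Ideal.mem_span_singleton'.1 (hentry i))
  change c i • x ^ 3 = (S.adjugate.mulVecLin w) i
  rw [Matrix.mulVecLin_apply, ← hi, hc i]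

/-- **`G(4) ≤ 34` for the type `(1,2,1,1)`**: every coordinate of the representing vectors lies in
`x²R = ℂx² + ℂx³`. [cite: MignonRessayre2004, §2] -/
theorem rank_symmetrised_fin_four_form_le_of_oneTwoOneOne {σ : Type*} [Fintype σ] {x y : R}
    (hxy : x * y = 0) (hyy : y * y = x ^ 3) (hx4 : x ^ 4 = 0)
    (hloc : ∀ r : R, ∃ (c : ℂ) (a b : R), r = algebraMap ℂ R c + a * x + b * y)
    (l : R →ₗ[ℂ] ℂ) (S : Matrix (Fin 4) (Fin 4) R) (hS : ∀ i j, ∃ a b, S i j = a * x + b * y)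
    (τ : σ → R) (Z : σ → Matrix (Fin 4) (Fin 4) R) :
    (Matrix.of fun s t => l (τ s * (S.adjugate * Z t).trace + τ t * (S.adjugate * Z s).trace +
      ∑ r, ∑ r', if r' = r then 0 else ((S.updateRow r (Z t r)).updateRow r' (Z s r')).det)).rank ≤
      34 := by
  classical
  set I : Ideal R := Ideal.span {x, y} with hI
  have hSI : ∀ i j, S i j ∈ I := fun i j => by
    obtain ⟨a, b, h⟩ := hS i j
    exact Ideal.mem_span_pair.2 ⟨a, b, h.symm⟩
  have hI2 : I ^ 2 ≤ Ideal.span {x ^ 2} := sq_span_pair_le_span_sq hxy hyy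
  have hsq : ∀ z : R, z ∈ Ideal.span {x ^ 2} → ∃ c c' : ℂ, z = c • x ^ 2 + c' • x ^ 3 := by
    intro z hz
    obtain ⟨t, rfl⟩ := Ideal.mem_span_singleton'.1 hz
    exact mul_sq_eq_smul_add_smul hxy hx4 hloc t
  have hadj : ∀ i j, S.adjugate i j ∈ Ideal.span {x ^ 2} := by
    intro i j
    have h := adjugate_apply_mem_pow I S hSI i j
    simp only [Fintype.card_fin] at h
    exact hI2 (Ideal.pow_le_pow_right (by norm_num) h)
  have hβ : ∀ Y : Matrix (Fin 4) (Fin 4) R, (S.adjugate * Y).trace ∈ Ideal.span {x ^ 2} := by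
    intro Y
    rw [Matrix.trace]
    refine Ideal.sum_mem _ fun i _ => ?_
    rw [Matrix.diag_apply, Matrix.mul_apply]
    exact Ideal.sum_mem _ fun j _ => Ideal.mul_mem_right _ _ (hadj i j)
  let T₂ : (ℂ × ℂ) × (Fin 4 → Fin 4 → ℂ × ℂ) →ₗ[ℂ] R × Matrix (Fin 4) (Fin 4) R :=
    { toFun := fun p => (p.1.1 • x ^ 2 + p.1.2 • x ^ 3,
        Matrix.of fun k l => (p.2 k l).1 • x ^ 2 + (p.2 k l).2 • x ^ 3)
      map_add' := fun p p' => by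
        ext
        · simp only [Prod.fst_add, Prod.snd_add, add_smul]; abel
        · simp only [Prod.snd_add, Pi.add_apply, Prod.fst_add, Matrix.of_apply, Matrix.add_apply,
            add_smul]; abel
      map_smul' := fun c p => by
        ext
        · simp only [Prod.smul_fst, Prod.smul_snd, smul_eq_mul, RingHom.id_apply, smul_add, mul_smul]
        · simp only [Prod.smul_snd, Pi.smul_apply, Prod.smul_fst, smul_eq_mul, Matrix.of_apply,
            RingHom.id_apply, Matrix.smul_apply, smul_add, mul_smul] }
  have hV : Module.finrank ℂ (LinearMap.range T₂) ≤ 34 := by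
    refine (LinearMap.finrank_range_le T₂).trans ?_
    simp [Module.finrank_prod, Module.finrank_pi_fintype]
  refine (rank_symmetrised_form_le_finrank l S τ Z (LinearMap.range T₂) fun s => ?_).trans hV
  have h1 := hsq _ (hβ (Z s))
  have h2 : ∀ k l, τ s * (S.adjugate * Matrix.single k l 1).trace +
      (∑ r, ∑ r', if r' = r then 0 else
        ((S.updateRow r (Z s r)).updateRow r' (Matrix.single k l (1 : R) r')).det) ∈
      Ideal.span {x ^ 2} := by
    intro k l
    refine Ideal.add_mem _ (Ideal.mul_mem_left _ _ (hβ _)) ?_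
    refine Ideal.sum_mem _ fun r _ => Ideal.sum_mem _ fun r' _ => ?_
    split_ifs
    · exact Ideal.zero_mem _
    · exact hI2 (det_updateRow_updateRow_mem_sq_four I S hSI r r' _ _)
  obtain ⟨c₀, c₀', hc₀⟩ := h1
  choose d d' hdd using fun k l => hsq _ (h2 k l)
  refine ⟨((c₀, c₀'), fun k l => (d k l, d' k l)), ?_⟩
  ext
  · exact hc₀.symm
  · simp only [Matrix.of_apply]
    exact (hdd _ _).symm

/-- **The residual-corank-`4` (top-of-window) bound for the type `(1,2,1,1)`**: at `A(p) = diag(1_κ, S)`,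
`S ∈ Mat₄((x, y))`, `det S = 0`: `rank Hess λ(det A)(p) ≤ 34 + 8|κ|`. [cite: MignonRessayre2004, §2] -/
theorem rank_hess0_transl_le_blockNormalForm_four_of_oneTwoOneOne {σ : Type*} [Fintype σ]
    [DecidableEq σ] {κ : Type*} [Fintype κ] [DecidableEq κ] {x y : R}
    (hxy : x * y = 0) (hyy : y * y = x ^ 3) (hx4 : x ^ 4 = 0)
    (hloc : ∀ r : R, ∃ (c : ℂ) (a b : R), r = algebraMap ℂ R c + a * x + b * y)
    (l : R →ₗ[ℂ] ℂ) (A : Matrix (κ ⊕ Fin 4) (κ ⊕ Fin 4) (MvPolynomial σ R)) (F : MvPolynomial σ ℂ)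
    (hA : ∀ a b, (A a b).totalDegree ≤ 1) (hF : ∀ d, l (coeff d A.det) = coeff d F)
    (p : σ → ℂ) (S : Matrix (Fin 4) (Fin 4) R)
    (hB : A.map (eval fun i => algebraMap ℂ R (p i)) = Matrix.fromBlocks 1 0 0 S)
    (hS : ∀ i j, ∃ a b, S i j = a * x + b * y) (hdet : S.det = 0) :
    (hess0 (transl p F)).rank ≤ 34 + Fintype.card κ * 8 := by
  classical
  have h := rank_hess0_transl_le_of_blockNormalForm_general l A F hA hF p S hB hdet
    (fun s => A.map fun a => eval (fun i => algebraMap ℂ R (p i)) (pderiv s a)) (fun _ => rfl)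
    (rank_symmetrised_fin_four_form_le_of_oneTwoOneOne hxy hyy hx4 hloc l S hS
      (fun s => (A.map fun a => eval (fun i => algebraMap ℂ R (p i)) (pderiv s a)).toBlocks₁₁.trace)
      (fun s => (A.map fun a => eval (fun i => algebraMap ℂ R (p i)) (pderiv s a)).toBlocks₂₂))
  have h₁ := finrank_range_adjugate_mulVecLin_le_four_of_oneTwoOneOne hxy hyy hx4 hloc S hS
  have h₂ := finrank_range_adjugate_mulVecLin_le_four_of_oneTwoOneOne hxy hyy hx4 hloc Sᵀ
    (fun i j => hS j i)
  rw [← Matrix.adjugate_transpose] at h₂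
  have h8 : Fintype.card κ *
      (Module.finrank ℂ (LinearMap.range (S.adjugate.mulVecLin.restrictScalars ℂ)) +
        Module.finrank ℂ (LinearMap.range (S.adjugateᵀ.mulVecLin.restrictScalars ℂ))) ≤
      Fintype.card κ * 8 := Nat.mul_le_mul_left _ (by omega)
  omega

/-- The same in the shape `2 · dim R · n`, `n = |κ| + 4` (`dim R ≥ 5`). [cite: MignonRessayre2004, §2] -/
theorem rank_hess0_transl_le_blockNormalForm_four_of_oneTwoOneOne' {σ : Type*} [Fintype σ]
    [DecidableEq σ] {κ : Type*} [Fintype κ] [DecidableEq κ] {x y : R}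
    (hxy : x * y = 0) (hyy : y * y = x ^ 3) (hx4 : x ^ 4 = 0)
    (hloc : ∀ r : R, ∃ (c : ℂ) (a b : R), r = algebraMap ℂ R c + a * x + b * y)
    (hR : 5 ≤ Module.finrank ℂ R) (l : R →ₗ[ℂ] ℂ)
    (A : Matrix (κ ⊕ Fin 4) (κ ⊕ Fin 4) (MvPolynomial σ R)) (F : MvPolynomial σ ℂ)
    (hA : ∀ a b, (A a b).totalDegree ≤ 1) (hF : ∀ d, l (coeff d A.det) = coeff d F)
    (p : σ → ℂ) (S : Matrix (Fin 4) (Fin 4) R)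
    (hB : A.map (eval fun i => algebraMap ℂ R (p i)) = Matrix.fromBlocks 1 0 0 S)
    (hS : ∀ i j, ∃ a b, S i j = a * x + b * y) (hdet : S.det = 0) :
    (hess0 (transl p F)).rank ≤ 2 * Module.finrank ℂ R * (Fintype.card κ + 4) := by
  have h := rank_hess0_transl_le_blockNormalForm_four_of_oneTwoOneOne hxy hyy hx4 hloc l A F hA hF p
    S hB hS hdet
  have h40 : 34 + Fintype.card κ * 8 ≤ 2 * Module.finrank ℂ R * (Fintype.card κ + 4) := by nlinarith
  exact h.trans h40

end GFour

end Summit.ValiantsHypothesis.ValiantsHypothesis.Theorems.GrenetZeonPolySizeQPAlgebra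

end
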